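import Literature.AnabelianGeometry.EtaleTheta.TemperedFrobenioidToyConeSwap
import HarnessLib

/-!
# [EtTh] Cor. 3.8 sub-DAG, row F-2809 `PreservesPreSteps`: the clause "`D_i` of FSMFF-type" of `Cor38Hyp` is
# LOAD-BEARING — a kernel tightness certificate by the positive-cone variant of [FrdI] Example 3.9 (part 3, proof-only)

S. Mochizuki, *The étale theta function and its Frobenioid-theoretic manifestations*, Publ. RIMS **45** (2009),
Cor. 3.8 pp. 80–81, proof p. 81 l. 2–3: "by [Mzk17], Theorem 3.4, (ii) … it follows that `Ψ` preserves pre-steps"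
[cite: MochizukiEtTh2009, Cor 3.8 p.81]; S. Mochizuki, *The geometry of Frobenioids I*, Kyushu J. Math. **62** (2008),
Example 3.9 p. 72, §0 pp. 14, 17–18 (FSM-, FSMI-morphisms, categories of FSMFF-type), Rem. 3.1.3 p. 58, Def. 1.2 (iii)
p. 22 (pre-steps) [cite: MochizukiFrdI2008, Rem. 3.1.3 p.58].

abc-iut cell, block F (fact-proving wave), seat abc-iut-f-032 (gen 6).  PROOF-ONLY companion (0 definitions) of
abc-iut-w5-d124's statements-first sub-DAG `TemperedFrobenioidCor38Sub.lean`; data = `TemperedFrobenioidToyCone.lean` +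
`TemperedFrobenioidToyConeSwap.lean` (this seat).  Row **F-2809** `Cor38Hyp.PreservesPreSteps`: INSTANCE forms PROVED
(`preservesPreSteps_of_thm34ii`, `preservesPreSteps_of_fact`); bare universal closure undecided-as-typed, desk verdict TRUE.
Every separating-model attempt of record PRESERVES pre-steps (the seven toys of `TemperedFrobenioidCor38SubPreStepsWitnesses`,
`OTriTwist.preservesPreSteps_hyp` — groupoid base —, `DilSwap.preservesMor_isPreStep_swap` — the degree↔dilation swap of
abc-iut-f-142 fixes `(1, 1, z)`).  THIS file certifies the one mechanism that MOVES pre-steps and what closes it, exactly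
parallel to abc-iut-f-142's `DilSwap.preservesLinear_shape_false_without_fsmff` for F-2815:

* `not_preservesMor_isPreStep` — for the positive-cone record `ConeTwist.C` (base `SingleObj (ℚ_{≥0} ⋊ N)`: translations
  `u ≥ 0` only, invertible iff `u = 0`) the self-equivalence `Ψ = ConeTwist.swapEquiv` sends the PRE-STEP
  `π₀ = (1, 1_W, (1,0))` of the Frobenius-trivial object to `(1, (1,1), (0,0))`, whose base `(1,1)` is NOT an isomorphism
  (`not_isPreStep_swap_π₀`) — the `Ψ`-half of the body of `PreservesPreSteps` fails, although Frobenius degrees are fixed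
  (`preservesMor_isLinear_swap`: the mechanism is invisible to F-2815) and both non-dilating vocabulary clauses hold
  (`nonDilating_clause`) — `preservesPreSteps_shape_false_without_fsmff`;
* `not_isOfFSMFFType_D` — the base is NOT of FSMFF-type: the translation `t = (1,1)` is a non-invertible FSM-morphism whose
  FSMI factorisation would begin with an FSMI endomorphism of the unique object, excluded by [FrdI] §0 p. 18 (the argument
  of Rem. 3.1.3 for `ℕ_{≥1}`); hence `isEmpty_cor38Hyp_left/right`: NO record `Cor38Hyp` has `ConeTwist.C` as a component
  and the swap is NOT a counterexample to F-2809.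
READING (cell vocabulary): F-2809's closure stays undecided-as-typed with desk verdict TRUE; this file proves that any proof
of it must USE `h.fsmff` — exchanging non-invertible base translations with effective divisors is a self-equivalence of a
model-Frobenioid category that the model construction alone does not exclude (with an FSMFF base, an auxiliary object with
trivial endomorphisms re-pins the base-identity arrows).  No FACT-LIST label changes (NV datum).  HONEST FRAMING: bookkeeping
about OUR typed interfaces; not a statement about Cor. 3.8 / [FrdI] Thm. 3.4 (ii) as printed (whose FSMFF hypothesis the toy
violates by design); refereed pre-IUT material; nothing here bears on the disputed [IUTchIII] Cor. 3.12; no side taken;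
typed ≠ proved.
-/

noncomputable section

namespace Literature.AnabelianGeometry.EtaleTheta

open CategoryTheory Opposite Literature.AlgebraicGeometry.Frobenioids

namespace ConeTwist

open RatSemidirect Ex39

/-! ### §3  The base is not of FSMFF-type; pre-steps are NOT preserved; the tightness statement for F-2809 -/

/-- `t` is an FSM-morphism of `D = SingleObj W`: a monomorphism (cancellation in `G`) and fiberwise-surjective
(`t·γ = γ·(n_γ, 1)`). [cite: MochizukiFrdI2008, §0 p.14] -/
theorem isFSM_t : IsFSM (show SingleObj.star ConeTwist.W ⟶ SingleObj.star ConeTwist.W from ConeTwist.t) := by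
  refine ⟨fun X γ => ?_, ⟨fun f g h => ?_⟩⟩
  · let γ' : W := γ
    refine ⟨X, γ, (⟨⟨((γ'.1).n : ℚ), 1⟩, le_of_lt (γ'.1).n.2⟩ : W), ?_⟩
    show t * γ' = γ' * _
    refine Subtype.ext (G.ext ?_ ?_)
    · change (1 : ℚ) + (((1 : N) : ℚ))⁻¹ * (γ'.1).u = (γ'.1).u + ((γ'.1).n : ℚ)⁻¹ * ((γ'.1).n : ℚ)
      rw [Positive.val_one, inv_one, one_mul, inv_mul_cancel₀ (ne_of_gt (γ'.1).n.2), add_comm]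
    · change (1 : N) * (γ'.1).n = (γ'.1).n * 1
      rw [one_mul, mul_one]
  · have h' : t * (show W from f) = t * (show W from g) := h
    exact (Subtype.ext (mul_left_cancel (congrArg Subtype.val h')) : (show W from f) = (show W from g))

/-- `t` is not an isomorphism of `D` (`(1,1)` is not a unit of the cone). [cite: MochizukiFrdI2008, §0 p.14] -/
theorem not_isIso_t : ¬ IsIso (show SingleObj.star ConeTwist.W ⟶ SingleObj.star ConeTwist.W from ConeTwist.t) := fun h =>
  one_ne_zero ((show ((t : W) : G).u = 1 from rfl).symm.trans (u_eq_zero_of_isUnit ((SingleObj.isIso_iff_isUnit _).mp h)))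

/-- **The base `SingleObj (ℚ_{≥0} ⋊ N)` is NOT of FSMFF-type**: `t` is a non-invertible FSM-morphism, whose FSMI
factorisation would begin with an FSMI endomorphism of the unique object — excluded by [FrdI] §0 p. 18 (the
argument of Rem. 3.1.3 for `ℕ_{≥1}`). [cite: MochizukiFrdI2008, Rem. 3.1.3 p.58] -/
theorem not_isOfFSMFFType_D : ¬ IsOfFSMFFType ConeTwist.D := by
  intro h
  obtain ⟨n, hn⟩ := h.factors _ isFSM_t not_isIso_t
  obtain ⟨X, ψ, hψ⟩ := hn.exists_isFSMI
  obtain rfl : X = SingleObj.star W := Subsingleton.elim _ _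
  exact h.not_isFSMI_of_endomorphism ψ hψ

/-- NO record `Cor38Hyp C C'` exists with this `C` on the left (its base is not of FSMFF-type) …
[cite: MochizukiEtTh2009, Cor 3.8 p.80] -/
theorem isEmpty_cor38Hyp_left {D₀' : Type} [Category.{0} D₀'] {T' : RealifiedDivisorMonoids (D₀ := D₀') Toy.monoidVocab}
    {D' : Type} [Category.{0} D'] {VD' : FrdICatStub.{0, 0, 0} D'} (C' : TemperedFrobenioid T' D' VD') :
    IsEmpty (Cor38Hyp ConeTwist.C C') :=
  ⟨fun h => not_isOfFSMFFType_D h.fsmff.1⟩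

/-- … nor on the right. [cite: MochizukiEtTh2009, Cor 3.8 p.80] -/
theorem isEmpty_cor38Hyp_right {D₀' : Type} [Category.{0} D₀'] {T' : RealifiedDivisorMonoids (D₀ := D₀') Toy.monoidVocab}
    {D' : Type} [Category.{0} D'] {VD' : FrdICatStub.{0, 0, 0} D'} (C' : TemperedFrobenioid T' D' VD') :
    IsEmpty (Cor38Hyp C' ConeTwist.C) :=
  ⟨fun h => not_isOfFSMFFType_D h.fsmff.2⟩

/-- `π₀` is a pre-step: linear, with base the identity. [cite: MochizukiFrdI2008, Def. 1.2 (iii) p.22] -/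
theorem isPreStep_π₀ : ConeTwist.C.opsData.IsPreStep ConeTwist.π₀ := by
  refine ⟨?_, ?_⟩
  · change ModelFrobenioid.degFr π₀ = 1
    rfl
  · change IsIso (ModelFrobenioid.baseMap π₀)
    exact (inferInstance : IsIso (𝟙 (SingleObj.star W)))

/-- **`swap π₀ = (1, (1,1), (0,0))` is NOT a pre-step**: its base `(1,1) = t` is not an isomorphism of `D`.
[cite: MochizukiFrdI2008, Ex. 3.9 p.72] -/
theorem not_isPreStep_swap_π₀ : ¬ ConeTwist.C.opsData.IsPreStep (ConeTwist.swap.map ConeTwist.π₀) := by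
  rintro ⟨-, hiso⟩
  have hiso' : IsIso (show SingleObj.star W ⟶ SingleObj.star W from swapBase π₀) := hiso
  have hu := u_eq_zero_of_isUnit ((SingleObj.isIso_iff_isUnit _).mp hiso')
  have hg : gOf π₀ = 1 := rfl
  have hz : zOf π₀ = ((1 : ℚ), (0 : ℕ)) := rfl
  have h1 : ((swapBase π₀ : W) : G).u = 1 := by
    rw [swapBase_u, hg, hz, G.one_n, Positive.val_one, one_mul]
  exact one_ne_zero (h1.symm.trans hu)

/-- **`Ψ = swapEquiv` does NOT preserve pre-steps** — the `Ψ`-half of the shape of row F-2809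
`Cor38Hyp.PreservesPreSteps` FAILS for this self-equivalence of the category of a typed tempered Frobenioid.
[cite: MochizukiEtTh2009, Cor 3.8 p.81] -/
theorem not_preservesMor_isPreStep :
    ¬ PreFrobenioidData.PreservesMor ConeTwist.swapEquiv.functor ConeTwist.C.opsData.IsPreStep
        ConeTwist.C.opsData.IsPreStep := fun h =>
  not_isPreStep_swap_π₀ (h π₀ isPreStep_π₀)

/-- The swap PRESERVES linear morphisms (Frobenius degrees are fixed): the mechanism is invisible to the shape of
row F-2815. [cite: MochizukiEtTh2009, Cor 3.8 p.81] -/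
theorem preservesMor_isLinear_swap :
    PreFrobenioidData.PreservesMor ConeTwist.swap ConeTwist.C.opsData.IsLinear ConeTwist.C.opsData.IsLinear :=
  fun _ _ _ h => h

/-- "Non-dilating" is carried by `Cor38Hyp` only as the vocabulary clause `V.IsNonDilating`, which the trivial
vocabulary satisfies. [cite: MochizukiEtTh2009, Cor 3.8 p.80] -/
theorem nonDilating_clause :
    ∀ (A : (ConeTwist.D)ᵒᵖ) (f : A ⟶ A),
      Toy.monoidVocab.IsNonDilating (ConeTwist.C.Φ.carrier A) (ConeTwist.C.Φ.pull f) :=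
  fun _ _ => trivial

/-- **TIGHTNESS of `Cor38Hyp.fsmff` for row F-2809 (`PreservesPreSteps`)**: over the typed Def. 3.6 data there is a
tempered Frobenioid `C` (the positive cones of [FrdI] Ex. 3.9 over the one-object base `SingleObj (ℚ_{≥0} ⋊ N)`)
and a self-equivalence `Ψ` of its category such that EVERY clause of `Cor38Hyp C C` other than "`D_i` of
FSMFF-type" holds (`Ψ`, the two non-dilating vocabulary clauses) while the body of `PreservesPreSteps` FAILS. Hence
any proof of the universal closure of F-2809 must use `h.fsmff`. [cite: MochizukiEtTh2009, Cor 3.8 p.81] -/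
theorem preservesPreSteps_shape_false_without_fsmff :
    ∃ Ψ : ConeTwist.C.category ≌ ConeTwist.C.category,
      ((∀ (A : (ConeTwist.D)ᵒᵖ) (f : A ⟶ A),
          Toy.monoidVocab.IsNonDilating (ConeTwist.C.Φ.carrier A) (ConeTwist.C.Φ.pull f)) ∧
          ∀ (A : (ConeTwist.D)ᵒᵖ) (f : A ⟶ A),
            Toy.monoidVocab.IsNonDilating (ConeTwist.C.Φ.carrier A) (ConeTwist.C.Φ.pull f)) ∧
        ¬ (PreFrobenioidData.PreservesMor Ψ.functor ConeTwist.C.opsData.IsPreStep ConeTwist.C.opsData.IsPreStep ∧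
            PreFrobenioidData.PreservesMor Ψ.inverse ConeTwist.C.opsData.IsPreStep ConeTwist.C.opsData.IsPreStep) :=
  ⟨swapEquiv, ⟨nonDilating_clause, nonDilating_clause⟩, fun h => not_preservesMor_isPreStep h.1⟩

end ConeTwist

end Literature.AnabelianGeometry.EtaleTheta

end
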